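import Mathlib
import Summits.Ventures.PercRepro.TriangleCapThreeTrianglesD

/-!
# PercRepro — THE WINDMILL OF THREE TRIANGLES: THE `r = 2` CELL FOR EVERY `k ≥ 8` IN THE DENSE CORNER
(p3, gen 37; part 65)

`T₁ ∩ T₂ = T₁ ∩ T₃ = T₂ ∩ T₃ = {t}`; `S = T₁ ∪ T₂ ∪ T₃`, `|S| = 7`, `degIn S t = 6`, `degIn S = 2` elsewhere on `S`,
so `Q = 18` and `Σ_{T₁} + Σ_{T₂} + Σ_{T₃} degIn S = 30`; off `S`, a vertex hanging on `t` has `degIn S = 1` and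
`W = 6`, the others have `degIn S ≤ 3` and `W = 2 degIn S`.  The far count gives
`Σ_p deficit(p) ≥ 24 + 18 |Sᶜ| − 12 |H|` (`H` the hanging vertices), which is `≥ 4k + 6` as soon as some vertex
off `S` is not hanging — and «every vertex off `S` hangs on `t`» is not dense (`2m = 18 + 2 |Sᶜ| < 4k − 6`, the
hanging vertices being pairwise non-adjacent since every triangle is one of the three).

* **`three_triangles_stability_two_of_path`** — the `r = 2` stability for a path of three triangles, `k ≥ 9`
  (its far count is in TriangleCapThreeTrianglesD);
* **`four_mul_card_add_six_le_sum_deficit_of_windmill`** — the far count, `k ≥ 8`, `m ≥ 2k − 3`;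
* **`three_triangles_stability_two_of_windmill`** — the `r = 2` stability, `k ≥ 8`, `m ≥ 2k − 3`.
Axioms: standard.
-/

namespace PercRepro

namespace TriangleCap

namespace C047

open Finset

variable {V : Type*} [Fintype V] [DecidableEq V]

/-- **THE `r = 2` STABILITY FOR THREE TRIANGLES IN A PATH, `k ≥ 9`.** -/
theorem three_triangles_stability_two_of_path (D : SimpleGraph V) [DecidableRel D.Adj] (hK : K4mFree D)
    (hk : 9 ≤ Fintype.card V) (T₁ T₂ T₃ : Finset V) (h₁ : T₁.card = 3) (h₂ : T₂.card = 3) (h₃ : T₃.card = 3)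
    {t t' : V} (hint : T₁ ∩ T₂ = {t}) (hint' : T₂ ∩ T₃ = {t'}) (h13 : Disjoint T₁ T₃)
    (hcl₁ : ∀ x ∈ T₁, ∀ y ∈ T₁, x ≠ y → D.Adj x y) (hcl₂ : ∀ x ∈ T₂, ∀ y ∈ T₂, x ≠ y → D.Adj x y)
    (hcl₃ : ∀ x ∈ T₃, ∀ y ∈ T₃, x ≠ y → D.Adj x y)
    (hone₁ : ∀ z, z ∉ T₁ → degIn D T₁ z ≤ 1) (hone₂ : ∀ z, z ∉ T₂ → degIn D T₂ z ≤ 1)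
    (hone₃ : ∀ z, z ∉ T₃ → degIn D T₃ z ≤ 1)
    (hT : ∀ x y z, D.Adj x y → D.Adj x z → D.Adj y z →
      (x ∈ T₁ ∧ y ∈ T₁) ∨ (x ∈ T₂ ∧ y ∈ T₂) ∨ (x ∈ T₃ ∧ y ∈ T₃)) :
    ∑ v, deg D v * deg D v + 2 * (Fintype.card V - 3) ≤ D.edgeFinset.card * Fintype.card V := by
  have hdef := four_mul_card_add_six_le_sum_deficit_of_path D T₁ T₂ T₃ h₁ h₂ h₃ hint hint' h13
    hcl₁ hcl₂ hcl₃ hone₁ hone₂ hone₃ hk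
  have h18 := card_triangles3_le_eighteen_of_three D T₁ T₂ T₃ h₁ h₂ h₃ hcl₁ hcl₂ hcl₃ hT
    (fun x y z z' hxy hxz hyz hxz' hyz' => eq_of_common_nbr D hK hxy hxz hyz hxz' hyz')
  have hid := two_mul_sum_deg_sq_add_sum_deficit D
  have hmk : 2 * (D.edgeFinset.card * Fintype.card V) = 2 * D.edgeFinset.card * Fintype.card V := by ring
  omega

/-- **THE FAR COUNT FOR THE WINDMILL:** `4k + 6 ≤ Σ_p deficit(p)` for `k ≥ 8` in the dense corner. -/
theorem four_mul_card_add_six_le_sum_deficit_of_windmill (D : SimpleGraph V) [DecidableRel D.Adj]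
    (T₁ T₂ T₃ : Finset V) (h₁ : T₁.card = 3) (h₂ : T₂.card = 3) (h₃ : T₃.card = 3) {t : V}
    (h12 : T₁ ∩ T₂ = {t}) (h13 : T₁ ∩ T₃ = {t}) (h23 : T₂ ∩ T₃ = {t})
    (hcl₁ : ∀ x ∈ T₁, ∀ y ∈ T₁, x ≠ y → D.Adj x y) (hcl₂ : ∀ x ∈ T₂, ∀ y ∈ T₂, x ≠ y → D.Adj x y)
    (hcl₃ : ∀ x ∈ T₃, ∀ y ∈ T₃, x ≠ y → D.Adj x y)
    (hone₁ : ∀ z, z ∉ T₁ → degIn D T₁ z ≤ 1) (hone₂ : ∀ z, z ∉ T₂ → degIn D T₂ z ≤ 1)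
    (hone₃ : ∀ z, z ∉ T₃ → degIn D T₃ z ≤ 1)
    (hT : ∀ x y z, D.Adj x y → D.Adj x z → D.Adj y z →
      (x ∈ T₁ ∧ y ∈ T₁) ∨ (x ∈ T₂ ∧ y ∈ T₂) ∨ (x ∈ T₃ ∧ y ∈ T₃))
    (hk : 8 ≤ Fintype.card V) (hm : 2 * Fintype.card V ≤ D.edgeFinset.card + 3) :
    4 * Fintype.card V + 6 ≤ ∑ p ∈ adjPairsAll D, deficit D p := by
  have hi12 : (T₁ ∩ T₂).card ≤ 1 := by rw [h12, card_singleton]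
  have hi13 : (T₁ ∩ T₃).card ≤ 1 := by rw [h13, card_singleton]
  have hi23 : (T₂ ∩ T₃).card ≤ 1 := by rw [h23, card_singleton]
  have hcount := three_triangles_far_count D T₁ T₂ T₃ h₁ h₂ h₃ hi12 hi13 hi23 hcl₁ hcl₂ hcl₃
  have ht1 : t ∈ T₁ := (mem_inter.mp (by rw [h12]; exact mem_singleton_self t)).1
  have ht2 : t ∈ T₂ := (mem_inter.mp (by rw [h12]; exact mem_singleton_self t)).2
  have ht3 : t ∈ T₃ := (mem_inter.mp (by rw [h13]; exact mem_singleton_self t)).2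
  set S := T₁ ∪ T₂ ∪ T₃ with hS
  have hin12 : ∀ x, x ∈ T₁ → x ∈ T₂ → x = t := fun x a b => by
    have : x ∈ T₁ ∩ T₂ := mem_inter.mpr ⟨a, b⟩
    rwa [h12, mem_singleton] at this
  have hin13 : ∀ x, x ∈ T₁ → x ∈ T₃ → x = t := fun x a b => by
    have : x ∈ T₁ ∩ T₃ := mem_inter.mpr ⟨a, b⟩
    rwa [h13, mem_singleton] at this
  have hin23 : ∀ x, x ∈ T₂ → x ∈ T₃ → x = t := fun x a b => by
    have : x ∈ T₂ ∩ T₃ := mem_inter.mpr ⟨a, b⟩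
    rwa [h23, mem_singleton] at this
  have h12card : (T₁ ∪ T₂).card = 5 := by
    have := card_union_add_card_inter T₁ T₂
    rw [h12, card_singleton, h₁, h₂] at this
    omega
  have hScard : S.card = 7 := by
    have := card_union_add_card_inter (T₁ ∪ T₂) T₃
    have hi : (T₁ ∪ T₂) ∩ T₃ = {t} := by
      rw [union_inter_distrib_right, h13, h23, union_self]
    rw [hi, card_singleton, h12card, h₃] at this
    rw [hS]; omega
  have hRcard : Sᶜ.card + 7 = Fintype.card V := by rw [card_compl, hScard]; omega
  have htS : t ∈ S := mem_union_left _ (mem_union_left _ ht1)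
  have hmem : ∀ x ∈ S, x ∈ T₁ ∨ x ∈ T₂ ∨ x ∈ T₃ := by
    intro x hx
    rw [hS, mem_union, mem_union] at hx
    tauto
  have hmemS : ∀ x, x ∈ T₁ ∨ x ∈ T₂ ∨ x ∈ T₃ → x ∈ S := by
    intro x hx
    rw [hS, mem_union, mem_union]
    tauto
  -- the degrees into `S`: `6` at `t`, exactly `2` elsewhere
  have hcr_t : degIn D S t = 6 := by
    have hsub : S.filter (fun y => D.Adj t y) = S.erase t := by
      ext y
      rw [mem_filter, mem_erase]
      constructor
      · rintro ⟨hy, hty⟩; exact ⟨hty.ne.symm, hy⟩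
      · rintro ⟨hyt, hy⟩
        refine ⟨hy, ?_⟩
        rcases hmem y hy with h | h | h
        · exact hcl₁ t ht1 y h (Ne.symm hyt)
        · exact hcl₂ t ht2 y h (Ne.symm hyt)
        · exact hcl₃ t ht3 y h (Ne.symm hyt)
    unfold degIn
    rw [hsub, card_erase_of_mem htS, hScard]
  have hnb : ∀ (T' : Finset V) (x : V), t ∈ T' → (∀ z, z ∉ T' → degIn D T' z ≤ 1) → x ∉ T' → D.Adj x t →
      ∀ y ∈ T', D.Adj x y → y = t := fun T' x ht' hone hx' hxt' y hy hxy =>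
    eq_of_degIn_le_one D (hone x hx') ht' hxt' hy hxy
  have hcr_side : ∀ x ∈ S, x ≠ t → degIn D S x = 2 := by
    intro x hx hxt
    rcases hmem x hx with h | h | h
    · have hxt' : D.Adj x t := hcl₁ x h t ht1 hxt
      have hx2 : x ∉ T₂ := fun h' => hxt (hin12 x h h')
      have hx3 : x ∉ T₃ := fun h' => hxt (hin13 x h h')
      have e : S.filter (fun y => D.Adj x y) = T₁.filter (fun y => D.Adj x y) := by
        ext y
        rw [mem_filter, mem_filter]
        constructor
        · rintro ⟨hy, hxy⟩
          refine ⟨?_, hxy⟩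
          rcases hmem y hy with hy' | hy' | hy'
          · exact hy'
          · rw [hnb T₂ x ht2 hone₂ hx2 hxt' y hy' hxy]; exact ht1
          · rw [hnb T₃ x ht3 hone₃ hx3 hxt' y hy' hxy]; exact ht1
        · rintro ⟨hy, hxy⟩; exact ⟨hmemS y (Or.inl hy), hxy⟩
      have := degIn_self_of_clique D h₁ hcl₁ h
      unfold degIn at this ⊢
      rw [e]; exact this
    · have hxt' : D.Adj x t := hcl₂ x h t ht2 hxt
      have hx1 : x ∉ T₁ := fun h' => hxt (hin12 x h' h)
      have hx3 : x ∉ T₃ := fun h' => hxt (hin23 x h h')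
      have e : S.filter (fun y => D.Adj x y) = T₂.filter (fun y => D.Adj x y) := by
        ext y
        rw [mem_filter, mem_filter]
        constructor
        · rintro ⟨hy, hxy⟩
          refine ⟨?_, hxy⟩
          rcases hmem y hy with hy' | hy' | hy'
          · rw [hnb T₁ x ht1 hone₁ hx1 hxt' y hy' hxy]; exact ht2
          · exact hy'
          · rw [hnb T₃ x ht3 hone₃ hx3 hxt' y hy' hxy]; exact ht2
        · rintro ⟨hy, hxy⟩; exact ⟨hmemS y (Or.inr (Or.inl hy)), hxy⟩
      have := degIn_self_of_clique D h₂ hcl₂ h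
      unfold degIn at this ⊢
      rw [e]; exact this
    · have hxt' : D.Adj x t := hcl₃ x h t ht3 hxt
      have hx1 : x ∉ T₁ := fun h' => hxt (hin13 x h' h)
      have hx2 : x ∉ T₂ := fun h' => hxt (hin23 x h' h)
      have e : S.filter (fun y => D.Adj x y) = T₃.filter (fun y => D.Adj x y) := by
        ext y
        rw [mem_filter, mem_filter]
        constructor
        · rintro ⟨hy, hxy⟩
          refine ⟨?_, hxy⟩
          rcases hmem y hy with hy' | hy' | hy'
          · rw [hnb T₁ x ht1 hone₁ hx1 hxt' y hy' hxy]; exact ht3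
          · rw [hnb T₂ x ht2 hone₂ hx2 hxt' y hy' hxy]; exact ht3
          · exact hy'
        · rintro ⟨hy, hxy⟩; exact ⟨hmemS y (Or.inr (Or.inr hy)), hxy⟩
      have := degIn_self_of_clique D h₃ hcl₃ h
      unfold degIn at this ⊢
      rw [e]; exact this
  -- `Q = 18` and the triangle sums `= 30`
  have hQ : adjPairs D S = 18 := by
    rw [adjPairs_eq_sum_degIn, ← add_sum_erase S _ htS, hcr_t]
    rw [sum_congr rfl (fun x hx => hcr_side x (mem_of_mem_erase hx) (ne_of_mem_erase hx)), sum_const,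
      card_erase_of_mem htS, hScard, smul_eq_mul]
  have hTsum : ∀ (T : Finset V), T.card = 3 → t ∈ T → T ⊆ S → ∑ x ∈ T, degIn D S x = 10 := by
    intro T hT ht hTS
    rw [← add_sum_erase T _ ht, hcr_t]
    rw [sum_congr rfl (fun x hx => hcr_side x (hTS (mem_of_mem_erase hx)) (ne_of_mem_erase hx)), sum_const,
      card_erase_of_mem ht, hT, smul_eq_mul]
  have hA1 := hTsum T₁ h₁ ht1 (fun x hx => hmemS x (Or.inl hx))
  have hA2 := hTsum T₂ h₂ ht2 (fun x hx => hmemS x (Or.inr (Or.inl hx)))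
  have hA3 := hTsum T₃ h₃ ht3 (fun x hx => hmemS x (Or.inr (Or.inr hx)))
  -- off `S`
  have hout : ∀ z ∈ Sᶜ, degIn D S z ≤ 3 := by
    intro z hz
    rw [mem_compl, hS, mem_union, mem_union, not_or, not_or] at hz
    have h := degIn_union_le D (T₁ ∪ T₂) T₃ z
    have h2 := degIn_union_le D T₁ T₂ z
    have := hone₁ z hz.1.1
    have := hone₂ z hz.1.2
    have := hone₃ z hz.2
    rw [hS]
    omega
  have hhang : ∀ z ∈ Sᶜ, D.Adj z t → S.filter (fun x => D.Adj z x) = {t} := by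
    intro z hz hzt
    rw [mem_compl, hS, mem_union, mem_union, not_or, not_or] at hz
    ext x
    rw [mem_filter, mem_singleton]
    constructor
    · rintro ⟨hx, hzx⟩
      rcases hmem x hx with h | h | h
      · exact eq_of_degIn_le_one D (hone₁ z hz.1.1) ht1 hzt h hzx
      · exact eq_of_degIn_le_one D (hone₂ z hz.1.2) ht2 hzt h hzx
      · exact eq_of_degIn_le_one D (hone₃ z hz.2) ht3 hzt h hzx
    · rintro rfl; exact ⟨htS, hzt⟩
  have hW : ∀ z ∈ Sᶜ, ∑ x ∈ S.filter (fun x => D.Adj z x), degIn D S x ≤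
      2 * degIn D S z + (if D.Adj z t then 4 else 0) := by
    intro z hz
    by_cases hzt : D.Adj z t
    · rw [hhang z hz hzt, sum_singleton, hcr_t, if_pos hzt]
      unfold degIn
      rw [hhang z hz hzt, card_singleton]
    · rw [if_neg hzt, add_zero]
      have : ∀ x ∈ S.filter (fun x => D.Adj z x), degIn D S x = 2 := by
        intro x hx
        rw [mem_filter] at hx
        apply hcr_side x hx.1
        rintro rfl
        exact hzt hx.2
      rw [sum_congr rfl this, sum_const, smul_eq_mul, mul_comm]
      rfl
  -- the pointwise bound off `S`: `4 W + 2 s² + 2 s d ≤ 14 s + 7 d + 12 [z ~ t]`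
  have hpt : ∀ z ∈ Sᶜ, 4 * ∑ x ∈ S.filter (fun x => D.Adj z x), degIn D S x +
      2 * (degIn D S z * degIn D S z) + 2 * (degIn D S z * degIn D Sᶜ z) ≤
      14 * degIn D S z + 7 * degIn D Sᶜ z + (if D.Adj z t then 12 else 0) := by
    intro z hz
    have hWz := hW z hz
    have hs := hout z hz
    by_cases hzt : D.Adj z t
    · have hs1 : degIn D S z = 1 := by unfold degIn; rw [hhang z hz hzt, card_singleton]
      rw [if_pos hzt] at hWz ⊢
      rw [hs1] at hWz ⊢
      omega
    · rw [if_neg hzt, add_zero] at hWz ⊢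
      set s := degIn D S z with hsdef
      clear_value s
      interval_cases s <;> omega
  have hptsum := sum_le_sum hpt
  rw [sum_add_distrib, sum_add_distrib, sum_add_distrib, sum_add_distrib, ← mul_sum, ← mul_sum, ← mul_sum,
    ← mul_sum, ← mul_sum] at hptsum
  have h12h : (∑ z ∈ Sᶜ, if D.Adj z t then 12 else 0) = 12 * (Sᶜ.filter (fun z => D.Adj z t)).card := by
    rw [← sum_filter, sum_const, smul_eq_mul, mul_comm]
  rw [h12h] at hptsum
  -- the hanging vertices: fewer than all of `Sᶜ`, by the density
  have hnot_all : (Sᶜ.filter (fun z => D.Adj z t)).card < Sᶜ.card := by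
    by_contra hall
    have hall' : Sᶜ.filter (fun z => D.Adj z t) = Sᶜ :=
      eq_of_subset_of_card_le (filter_subset _ _) (by omega)
    have hzt : ∀ z ∈ Sᶜ, D.Adj z t := by
      intro z hz
      rw [← hall', mem_filter] at hz
      exact hz.2
    have hdens := two_mul_card_edges_eq_adjPairs_add D S
    have hs1 : ∑ z ∈ Sᶜ, degIn D S z = Sᶜ.card := by
      rw [card_eq_sum_ones]
      apply sum_congr rfl
      intro z hz
      unfold degIn
      rw [hhang z hz (hzt z hz), card_singleton]
    have hd0 : ∑ z ∈ Sᶜ, degIn D Sᶜ z = 0 := by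
      apply sum_eq_zero
      intro z hz
      unfold degIn
      rw [card_eq_zero, filter_eq_empty_iff]
      intro y hy hzy
      have htri := hT z y t hzy (hzt z hz) (hzt y hy)
      rw [mem_compl] at hz
      rcases htri with ⟨h, -⟩ | ⟨h, -⟩ | ⟨h, -⟩
      · exact hz (hmemS z (Or.inl h))
      · exact hz (hmemS z (Or.inr (Or.inl h)))
      · exact hz (hmemS z (Or.inr (Or.inr h)))
    rw [hQ, hs1, hd0] at hdens
    omega
  rw [hScard, hQ] at hcount
  have hk' : Fintype.card V = Sᶜ.card + 7 := by omega
  rw [hk']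
  omega

/-- **THE `r = 2` STABILITY FOR THE WINDMILL, `k ≥ 8` IN THE DENSE CORNER.** -/
theorem three_triangles_stability_two_of_windmill (D : SimpleGraph V) [DecidableRel D.Adj] (hK : K4mFree D)
    (hk : 8 ≤ Fintype.card V) (hm : 2 * Fintype.card V ≤ D.edgeFinset.card + 3) (T₁ T₂ T₃ : Finset V)
    (h₁ : T₁.card = 3) (h₂ : T₂.card = 3) (h₃ : T₃.card = 3) {t : V}
    (h12 : T₁ ∩ T₂ = {t}) (h13 : T₁ ∩ T₃ = {t}) (h23 : T₂ ∩ T₃ = {t})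
    (hcl₁ : ∀ x ∈ T₁, ∀ y ∈ T₁, x ≠ y → D.Adj x y) (hcl₂ : ∀ x ∈ T₂, ∀ y ∈ T₂, x ≠ y → D.Adj x y)
    (hcl₃ : ∀ x ∈ T₃, ∀ y ∈ T₃, x ≠ y → D.Adj x y)
    (hone₁ : ∀ z, z ∉ T₁ → degIn D T₁ z ≤ 1) (hone₂ : ∀ z, z ∉ T₂ → degIn D T₂ z ≤ 1)
    (hone₃ : ∀ z, z ∉ T₃ → degIn D T₃ z ≤ 1)
    (hT : ∀ x y z, D.Adj x y → D.Adj x z → D.Adj y z →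
      (x ∈ T₁ ∧ y ∈ T₁) ∨ (x ∈ T₂ ∧ y ∈ T₂) ∨ (x ∈ T₃ ∧ y ∈ T₃)) :
    ∑ v, deg D v * deg D v + 2 * (Fintype.card V - 3) ≤ D.edgeFinset.card * Fintype.card V := by
  have hdef := four_mul_card_add_six_le_sum_deficit_of_windmill D T₁ T₂ T₃ h₁ h₂ h₃ h12 h13 h23
    hcl₁ hcl₂ hcl₃ hone₁ hone₂ hone₃ hT hk hm
  have h18 := card_triangles3_le_eighteen_of_three D T₁ T₂ T₃ h₁ h₂ h₃ hcl₁ hcl₂ hcl₃ hT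
    (fun x y z z' hxy hxz hyz hxz' hyz' => eq_of_common_nbr D hK hxy hxz hyz hxz' hyz')
  have hid := two_mul_sum_deg_sq_add_sum_deficit D
  have hmk : 2 * (D.edgeFinset.card * Fintype.card V) = 2 * D.edgeFinset.card * Fintype.card V := by ring
  omega

end C047

end TriangleCap

end PercRepro
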